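import Mathlib
import HarnessLib
import Summits.NavierStokesRegularity.NavierStokesRegularity.Theorems.UnthreadedRigidityDoorUnthreadedRigidityVirialHornShellFields
import Summits.NavierStokesRegularity.NavierStokesRegularity.Theorems.UnthreadedRigidityDoorUnthreadedRigidityVirialHornWindowRegularity
import Summits.NavierStokesRegularity.NavierStokesRegularity.Theorems.UnthreadedRigidityDoorUnthreadedRigidityThreadingJetsWindowSilence
import Summits.NavierStokesRegularity.NavierStokesRegularity.Theorems.UnthreadedRigidityDoorUnthreadedRigidityThreadingJetsSplitDefs

/-!
# Route `UnthreadedRigidityDoor`, item `UnthreadedRigidity` (W2, stmt-NavierStokesRegularity-27585) — THREADING JETS, WINDOW GENERICITY: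
# in a window the profile is ANALYTIC, so the genericity hypothesis of the slice law is free; bridge V-W from the GENERIC slice law
# (LINE g11-1 «VIRIAL HORN»; the CARD's residual R1 discharged at interior times)

Seat ns-crc-p1 g8 (director-ns dss_146 (1); the R1 correction of the two-hand split, dss bus 2026-08-29T07:45Z),
`--supports stmt-NavierStokesRegularity-27585 --as helper`.  Inputs BY NAME: crc-p2 g8's shell calculus (`VirialHorn.sepShellL_eq_comp_sub`,
`VirialHorn.inner_curl_curl_shell_self`, p704633/p706546) and window regularity (`VirialHorn.window_analyticOnNhd_slice`, p702598), engine-1 g71's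
`IsSolidHarmonic.apply_smul` (p703890), this seat's pressure gauge / window silence (p706013, p706266), slice reductions (p704808) and the split
Props (`OrderTwoSliceLawGeneric`, p707300).

THE POINT.  The (F2)+(F3) proof of the ORDER-TWO SLICE LAW divides by the vorticity amplitude `K = vortAmpL l H` (CARD §7, residual R1): it proves
`OrderTwoSliceLawGeneric` (= the slice law for profiles whose `K` has no plateau on `(0,∞)`), not `OrderTwoSliceLaw`.  For the WINDOW bridge V-W
this costs nothing:
* `eq_zero_of_vortAmpL_eq_zero`, `virialMoment_eq_zero_of_vortAmpL_eq_zero` — a virial-admissible profile with `K ≡ 0` on `(0,∞)` is NULL there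
  (`(r^{2l+2}H′)′ = r^{2l+2}K = 0`, the constant `r^{2l+2}H′` tends to `0` at `0⁺` by regularity at the apex, so `H′ ≡ 0`, and the constant `H` is
  `0` by the decay at infinity), so its virial moment vanishes;
* `inner_sepShellL_self` (radial read-off `⟪u(x₀+y), y⟫ = l(l+1)H(|y|)Y(y)` about any centre), ★ `analyticOnNhd_profile` — if the shell
  `sepShellL H Y x₀` is real-analytic on `ℝ³` and `Y ≢ 0` then `H` is real-analytic on `(0,∞)` (read off along a ray where `Y ≠ 0`);
* `analyticOnNhd_vortAmpL`, ★ `vortAmpL_generic_or_zero` — for an analytic profile, `K` either vanishes on no open sub-interval of `(0,∞)` or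
  vanishes identically there (principle of isolated zeros, `AnalyticOnNhd.eqOn_zero_of_preconnected_of_eventuallyEq_zero`);
* ★★ `virialWindowSilence_of_genericSliceLaw : OrderTwoSliceLawGeneric → (admissible shells have L⁴ slices) → VirialHorn.VirialWindowSilence` — every
  slice of the window is analytic (`window_analyticOnNhd_slice`), so at each time either the genericity hypothesis holds (and the pressure gauge + the
  open-window dictionary feed the generic slice law, as in `virialWindowSilence_of_sliceLaw`) or the profile is null (virial moment `0`) or the harmonic
  is null (angular form `0`).

So the WINDOW RUNG of LINE g11-1 no longer meets R1: V-W ⇐ (A) `OrderTwoLawSlice` ∧ (B′) `VirialLemmaSlice` (via `orderTwoSliceLawGeneric_of_split`,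
`…ThreadingJetsSplit`) ∧ the shell-`L⁴` fact (engine-1 g71).  The one-sided SLICE bridge V keeps R1 (no analyticity at `t₀`).

HONEST FRAMING: regularity/genericity bookkeeping (M-part) for HYPOTHETICAL window solutions on one RUNG line; (A), (B′) are NOT proved here; nothing
here bears on `UnthreadedRigidity` (27585), the door Target, W2 or Navier–Stokes regularity; no summit statement is proved.  MODEL/rung work. [folklore]
-/

noncomputable section

-- the summit and its single sub-problem share the name (CONVENTIONS §1), as in every Theorems file
set_option linter.dupNamespace false

namespace Summit.NavierStokesRegularity.NavierStokesRegularity.Theorems.UnthreadedRigidity.ThreadingJets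

open Set Function Filter Topology MeasureTheory
open scoped RealInnerProductSpace InnerProductSpace ContDiff Laplacian ENNReal NNReal
open Literature.Analysis.FluidPDE
open Literature.Analysis.UnboundedOperators (heatExtension)
open Summit.NavierStokesRegularity.NavierStokesRegularity.Theorems.UnthreadedRigidity.ProfileHorn (E3 threadingFlux)
open Summit.NavierStokesRegularity.NavierStokesRegularity.Theorems.UnthreadedRigidity.VirialHorn
  (IsSolidHarmonic VirialAdmissible sepShellL virialMoment angForm pbr det3 vortAmpL strainAmpL VirialWindowSilence)

/-! ### 1. Profiles without vorticity: `K ≡ 0` on `(0, ∞)` forces a null profile -/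

/-- Off the origin a virial-admissible profile is the smooth function `r ↦ h(r²)`, with `H′(r) = 2 r h′(r²)`. [folklore] -/
theorem virialAdmissible_hasDerivAt_of_pos {l : ℕ} {H : ℝ → ℝ} (hH : VirialAdmissible l H) :
    ∃ h : ℝ → ℝ, ContDiff ℝ (⊤ : ℕ∞) h ∧ (∀ r, 0 ≤ r → H r = h (r ^ 2)) ∧
      ∀ r, 0 < r → HasDerivAt H (2 * r * deriv h (r ^ 2)) r := by
  obtain ⟨h, hh, hHh⟩ := hH.1
  refine ⟨h, hh, hHh, fun r hr => ?_⟩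
  have hev : H =ᶠ[𝓝 r] fun s => h (s ^ 2) := by
    filter_upwards [Ioi_mem_nhds hr] with σ hσ
    exact hHh σ (le_of_lt hσ)
  have hd : HasDerivAt (fun s : ℝ => h (s ^ 2)) (deriv h (r ^ 2) * (2 * r)) r := by
    have h1 : HasDerivAt (fun s : ℝ => s ^ 2) (2 * r) r := by
      simpa using (hasDerivAt_pow 2 r)
    exact ((hh.differentiable (by simp)) (r ^ 2)).hasDerivAt.comp r h1
  exact (hd.congr_of_eventuallyEq hev).congr_deriv (by ring)

/-- **A virial-admissible profile with identically vanishing vorticity amplitude on `(0,∞)` is null there**: `K = H″ + 2(l+1)H′/r ≡ 0` means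
`(r^{2l+2} H′)′ = 0`, so `r^{2l+2}H′` is constant, `= 0` by letting `r → 0⁺` (regularity at the origin); hence `H` is constant on `(0,∞)`, `= 0` by
the decay at infinity. [folklore] -/
theorem eq_zero_of_vortAmpL_eq_zero {l : ℕ} {H : ℝ → ℝ} (hH : VirialAdmissible l H)
    (hK : ∀ r : ℝ, 0 < r → vortAmpL l H r = 0) : ∀ r : ℝ, 0 < r → H r = 0 ∧ deriv H r = 0 := by
  obtain ⟨h, hh, hHh, hder⟩ := virialAdmissible_hasDerivAt_of_pos hH
  obtain ⟨C, hC⟩ := hH.2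
  -- `H′` on `(0,∞)` and its derivative
  have hH' : ∀ r, 0 < r → deriv H r = 2 * r * deriv h (r ^ 2) := fun r hr => (hder r hr).deriv
  set D : ℝ → ℝ := fun r => 2 * r * deriv h (r ^ 2) with hD_def
  have hDc : ContDiff ℝ (⊤ : ℕ∞) D := by
    have h1 : ContDiff ℝ (⊤ : ℕ∞) (deriv h) := hh.deriv'  -- may need adjustment
    exact (contDiff_const.mul contDiff_id).mul (h1.comp (contDiff_id.pow 2))
  have hDev : ∀ r, 0 < r → deriv H =ᶠ[𝓝 r] D := fun r hr => by
    filter_upwards [Ioi_mem_nhds hr] with σ hσ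
    exact hH' σ hσ
  have hH'' : ∀ r, 0 < r → HasDerivAt (deriv H) (deriv D r) r := fun r hr =>
    (((hDc.differentiable (by simp)) r).hasDerivAt).congr_of_eventuallyEq (hDev r hr)
  -- `G = r^{2l+2} H′` has zero derivative on `(0,∞)`
  set G : ℝ → ℝ := fun r => r ^ (2 * l + 2) * deriv H r with hG_def
  have hGd : ∀ r, 0 < r → HasDerivAt G
      (((2 * l + 2 : ℕ) : ℝ) * r ^ (2 * l + 1) * deriv H r + r ^ (2 * l + 2) * deriv D r) r := fun r hr => by
    have h1 : HasDerivAt (fun s : ℝ => s ^ (2 * l + 2)) (((2 * l + 2 : ℕ) : ℝ) * r ^ (2 * l + 1)) r := by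
      simpa using hasDerivAt_pow (2 * l + 2) r
    exact h1.mul (hH'' r hr)
  have hG0 : ∀ r, 0 < r → deriv G r = 0 := fun r hr => by
    rw [(hGd r hr).deriv]
    have hKr := hK r hr
    have e2 : deriv (deriv H) r = deriv D r := (hH'' r hr).deriv
    unfold vortAmpL at hKr
    rw [e2] at hKr
    -- `hKr : deriv D r + 2(l+1)/r · H′ r = 0`
    have hr0 : r ≠ 0 := hr.ne'
    have e3 : deriv D r = -(2 * ((l : ℝ) + 1) / r * deriv H r) := by linarith
    rw [e3]
    have e4 : r ^ (2 * l + 2) = r ^ (2 * l + 1) * r := by ring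
    rw [e4]
    field_simp
    push_cast
    ring
  have hGdiff : DifferentiableOn ℝ G (Ioi 0) := fun r hr => (hGd r hr).differentiableAt.differentiableWithinAt
  have hGconst : ∀ r ∈ Ioi (0 : ℝ), ∀ s ∈ Ioi (0 : ℝ), G r = G s :=
    fun r hr s hs => isOpen_Ioi.is_const_of_deriv_eq_zero (convex_Ioi 0).isPreconnected hGdiff
      (fun x hx => hG0 x hx) hr hs
  -- the constant is `0`: `G(r) = 2 r^{2l+3} h′(r²) → 0` as `r → 0⁺`
  set g : ℝ → ℝ := fun r => r ^ (2 * l + 2) * D r with hg_def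
  have hgc : Continuous g := (continuous_id.pow _).mul hDc.continuous
  have hg0 : g 0 = 0 := by simp [hg_def]
  have hGg : ∀ r, 0 < r → G r = g r := fun r hr => by
    simp only [hG_def, hg_def, hD_def, hH' r hr]
  have hGzero : ∀ r, 0 < r → G r = 0 := by
    intro r hr
    -- `G` is constant `= G r` on `(0,∞)` and `g → g 0 = 0` at `0⁺`
    have hlim : Tendsto g (𝓝[>] (0 : ℝ)) (𝓝 (g 0)) := hgc.continuousAt.tendsto.mono_left nhdsWithin_le_nhds
    have hlim' : Tendsto (fun _ : ℝ => G r) (𝓝[>] (0 : ℝ)) (𝓝 (g 0)) := by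
      refine hlim.congr' ?_
      filter_upwards [self_mem_nhdsWithin] with s hs
      rw [← hGg s hs, hGconst s hs r hr]
    rw [hg0] at hlim'
    exact tendsto_nhds_unique tendsto_const_nhds hlim'
  -- hence `H′ ≡ 0` on `(0,∞)`
  have hH'0 : ∀ r, 0 < r → deriv H r = 0 := fun r hr => by
    have h1 := hGzero r hr
    simp only [hG_def] at h1
    rcases mul_eq_zero.1 h1 with h2 | h2
    · exact absurd h2 (pow_ne_zero _ hr.ne')
    · exact h2
  -- hence `H` is constant on `(0,∞)`, and the constant is `0` by decay
  have hHdiff : DifferentiableOn ℝ H (Ioi 0) := fun r hr => (hder r hr).differentiableAt.differentiableWithinAt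
  have hHconst : ∀ r ∈ Ioi (0 : ℝ), ∀ s ∈ Ioi (0 : ℝ), H r = H s :=
    fun r hr s hs => isOpen_Ioi.is_const_of_deriv_eq_zero (convex_Ioi 0).isPreconnected hHdiff
      (fun x hx => hH'0 x hx) hr hs
  have hH0 : ∀ r, 0 < r → H r = 0 := by
    intro r hr
    by_contra hne
    set d : ℝ := H r with hd_def
    -- `|d| s^{l+2} ≤ C` for all `s ≥ 1`, impossible for large `s`
    have hbd : ∀ s : ℝ, 1 ≤ s → s * |d| ≤ C := fun s hs => by
      have h1 := (hC s hs).1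
      rw [hHconst s (lt_of_lt_of_le one_pos hs) r hr] at h1
      have h2 : s ≤ s ^ (l + 2) := by
        calc s = s ^ 1 := (pow_one s).symm
          _ ≤ s ^ (l + 2) := pow_le_pow_right₀ hs (by omega)
      calc s * |d| ≤ s ^ (l + 2) * |d| := by gcongr
        _ ≤ C := h1
    have hdpos : 0 < |d| := abs_pos.2 hne
    set s : ℝ := max 1 ((C + 1) / |d|) with hs_def
    have hs1 : 1 ≤ s := le_max_left _ _
    have h3 := hbd s hs1
    have h4 : (C + 1) / |d| ≤ s := le_max_right _ _
    have h5 : C + 1 ≤ s * |d| := by rwa [div_le_iff₀ hdpos] at h4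
    linarith
  exact fun r hr => ⟨hH0 r hr, hH'0 r hr⟩

/-- … so its strain amplitude vanishes on `(0,∞)` and its VIRIAL MOMENT IS ZERO. [folklore] -/
theorem virialMoment_eq_zero_of_vortAmpL_eq_zero {l : ℕ} {H : ℝ → ℝ} (hH : VirialAdmissible l H)
    (hK : ∀ r : ℝ, 0 < r → vortAmpL l H r = 0) : virialMoment l H = 0 := by
  have h0 : ∀ r : ℝ, 0 < r → strainAmpL l H r = 0 := fun r hr => by
    obtain ⟨h1, h2⟩ := eq_zero_of_vortAmpL_eq_zero hH hK r hr
    simp [strainAmpL, h1, h2]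
  unfold virialMoment
  rw [setIntegral_congr_fun measurableSet_Ioi (fun r hr => by rw [h0 r hr])]
  simp


/-! ### 2. In a window the profile is analytic, so the vorticity amplitude is generic or vanishes identically -/

/-- RADIAL READ-OFF about any centre: `⟪sepShellL H Y x₀ (x₀ + y), y⟫ = l(l+1) H(|y|) Y(y)` (crc-p2 g8's `inner_curl_curl_shell_self` translated). [folklore] -/
theorem inner_sepShellL_self {l : ℕ} (hl : 1 ≤ l) {Y : E3 → ℝ} (hY : IsSolidHarmonic l Y) {H : ℝ → ℝ}
    (hH : VirialAdmissible l H) (x₀ y : E3) :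
    inner ℝ (sepShellL H Y x₀ (x₀ + y)) y = ((l : ℝ) * ((l : ℝ) + 1)) * (H ‖y‖ * Y y) := by
  obtain ⟨h, hh, hHh⟩ := hH.1
  rw [VirialHorn.sepShellL_eq_comp_sub hHh Y x₀]
  simp only [add_sub_cancel_left]
  rw [VirialHorn.inner_curl_curl_shell_self (hh.of_le (by norm_cast)) hY hl y, hHh ‖y‖ (norm_nonneg _)]

/-- A solid harmonic of positive degree vanishes at the origin. [folklore] -/
theorem IsSolidHarmonic.apply_zero {l : ℕ} (hl : 1 ≤ l) {Y : E3 → ℝ} (hY : IsSolidHarmonic l Y) : Y 0 = 0 := by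
  have h := hY.apply_smul 0 (0 : E3)
  rw [zero_smul, zero_pow (by omega), zero_mul] at h
  exact h

/-- ★ **The profile of an analytic separable shell is analytic off the origin**: if `sepShellL H Y x₀` is real-analytic on `ℝ³` (as every slice of a
bounded mild window is, `window_analyticOnNhd_slice`) and `Y ≢ 0`, then `H` is real-analytic on `(0, ∞)` — read off along a ray where `Y ≠ 0`:
`r ⟪e, u(x₀ + r e)⟫ = l(l+1) r^l Y(e) H(r)`. [folklore] -/
theorem analyticOnNhd_profile {l : ℕ} (hl : 1 ≤ l) {Y : E3 → ℝ} (hY : IsSolidHarmonic l Y) {H : ℝ → ℝ}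
    (hH : VirialAdmissible l H) (x₀ : E3) (hu : AnalyticOnNhd ℝ (sepShellL H Y x₀) univ)
    (hYne : ∃ y : E3, Y y ≠ 0) : AnalyticOnNhd ℝ H (Ioi 0) := by
  obtain ⟨y₀, hy₀⟩ := hYne
  have hy₀0 : y₀ ≠ 0 := by
    intro h0; rw [h0] at hy₀; exact hy₀ (IsSolidHarmonic.apply_zero hl hY)
  have hn : 0 < ‖y₀‖ := norm_pos_iff.2 hy₀0
  set e : E3 := (‖y₀‖⁻¹) • y₀ with he_def
  have he : ‖e‖ = 1 := by
    rw [he_def, norm_smul, Real.norm_of_nonneg (inv_nonneg.2 hn.le), inv_mul_cancel₀ hn.ne']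
  have hYe : Y e ≠ 0 := by
    rw [he_def, hY.apply_smul]
    exact mul_ne_zero (pow_ne_zero _ (inv_ne_zero hn.ne')) hy₀
  -- `φ r = ⟪e, u(x₀ + r e)⟫` is analytic on `ℝ`
  set φ : ℝ → ℝ := fun r => inner ℝ e (sepShellL H Y x₀ (x₀ + r • e)) with hφ_def
  have hφ : ∀ r : ℝ, AnalyticAt ℝ φ r := fun r => by
    have h1 : AnalyticAt ℝ (fun r : ℝ => x₀ + r • e) r := analyticAt_const.add (analyticAt_id.smul analyticAt_const)
    have h2 : AnalyticAt ℝ (fun r : ℝ => sepShellL H Y x₀ (x₀ + r • e)) r := (hu _ (mem_univ _)).comp h1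
    exact (innerSL ℝ e).analyticAt _ |>.comp h2
  -- on `(0,∞)`: `r φ(r) = l(l+1) r^l Y(e) H(r)`
  set c : ℝ := ((l : ℝ) * ((l : ℝ) + 1)) * Y e with hc_def
  have hc : c ≠ 0 := by
    rw [hc_def]
    refine mul_ne_zero (mul_ne_zero ?_ ?_) hYe
    · exact_mod_cast (show (l : ℕ) ≠ 0 by omega)
    · positivity
  have hφeq : ∀ r : ℝ, 0 < r → r * φ r = c * r ^ l * H r := by
    intro r hr
    have h1 := inner_sepShellL_self hl hY hH x₀ (r • e)
    rw [real_inner_smul_right, norm_smul, Real.norm_of_nonneg hr.le, he, mul_one, hY.apply_smul,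
      real_inner_comm] at h1
    rw [hφ_def, hc_def]
    simp only at h1 ⊢
    rw [h1]; ring
  -- hence `H = (r φ)/(c r^l)` on `(0,∞)`, analytic
  intro r hr
  have hr0 : (0 : ℝ) < r := hr
  have hev : (fun s : ℝ => s * φ s / (c * s ^ l)) =ᶠ[𝓝 r] H := by
    filter_upwards [Ioi_mem_nhds hr0] with s hs
    have hs0 : (0 : ℝ) < s := hs
    rw [hφeq s hs0]
    field_simp
  refine AnalyticAt.congr ?_ hev
  exact (analyticAt_id.mul (hφ r)).div (analyticAt_const.mul (analyticAt_id.pow l))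
    (mul_ne_zero hc (pow_ne_zero _ hr0.ne'))

/-- The vorticity amplitude of an analytic profile is analytic on `(0,∞)`. [folklore] -/
theorem analyticOnNhd_vortAmpL {l : ℕ} {H : ℝ → ℝ} (hHa : AnalyticOnNhd ℝ H (Ioi 0)) :
    AnalyticOnNhd ℝ (vortAmpL l H) (Ioi 0) := by
  have h1 : AnalyticOnNhd ℝ (deriv H) (Ioi 0) := hHa.deriv
  have h2 : AnalyticOnNhd ℝ (deriv (deriv H)) (Ioi 0) := h1.deriv
  intro r hr
  have hr0 : (r : ℝ) ≠ 0 := (show (0 : ℝ) < r from hr).ne'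
  show AnalyticAt ℝ (fun r => deriv (deriv H) r + 2 * ((l : ℝ) + 1) / r * deriv H r) r
  exact (h2 r hr).add ((analyticAt_const.div analyticAt_id hr0).mul (h1 r hr))

/-- ★ **Dichotomy for analytic profiles**: on `(0,∞)` the vorticity amplitude of an analytic profile either vanishes on NO open sub-interval
(the genericity hypothesis of `OrderTwoSliceLawGeneric`) or vanishes IDENTICALLY (principle of isolated zeros). [folklore] -/
theorem vortAmpL_generic_or_zero {l : ℕ} {H : ℝ → ℝ} (hHa : AnalyticOnNhd ℝ H (Ioi 0)) :
    (∀ a b : ℝ, 0 < a → a < b → ∃ r ∈ Ioo a b, vortAmpL l H r ≠ 0) ∨ (∀ r : ℝ, 0 < r → vortAmpL l H r = 0) := by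
  by_cases h : ∀ a b : ℝ, 0 < a → a < b → ∃ r ∈ Ioo a b, vortAmpL l H r ≠ 0
  · exact Or.inl h
  right
  push Not at h
  obtain ⟨a, b, ha, hab, hzero⟩ := h
  have hK := analyticOnNhd_vortAmpL (l := l) hHa
  have hm : (a + b) / 2 ∈ Ioo a b := ⟨by linarith, by linarith⟩
  have hev : vortAmpL l H =ᶠ[𝓝 ((a + b) / 2)] 0 := by
    filter_upwards [Ioo_mem_nhds hm.1 hm.2] with r hr
    exact hzero r hr
  have h0 := hK.eqOn_zero_of_preconnected_of_eventuallyEq_zero (convex_Ioi (0 : ℝ)).isPreconnected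
    (show (0 : ℝ) < (a + b) / 2 by linarith) hev
  exact fun r hr => h0 hr

/-! ### 3. Bridge V-W from the GENERIC slice law -/

/-- The angular form of the zero harmonic vanishes. [folklore] -/
theorem angForm_eq_zero_of_forall_eq_zero {Y : E3 → ℝ} (h : ∀ y : E3, Y y = 0) (ξ : E3) : angForm Y ξ = 0 := by
  have hY : Y = fun _ => 0 := funext h
  subst hY
  simp [angForm, pbr, det3]

/-- ★★ **BRIDGE V-W FROM THE GENERIC SLICE LAW** (modulo the `L⁴` size of admissible shells): in a window the genericity hypothesis of
`OrderTwoSliceLawGeneric` is FREE — every slice of a bounded mild window is real-analytic (`window_analyticOnNhd_slice`, p702598), so the profile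
`H_t` is analytic on `(0,∞)` (`analyticOnNhd_profile`) and its vorticity amplitude is generic or vanishes identically (`vortAmpL_generic_or_zero`);
in the latter case the profile is null (`eq_zero_of_vortAmpL_eq_zero`) and the virial moment is `0`.  The rest is `virialWindowSilence_of_sliceLaw`
(pressure gauge, open-window dictionary, Poisson at `t`). [folklore] -/
theorem virialWindowSilence_of_genericSliceLaw (hL : OrderTwoSliceLawGeneric)
    (h4 : ∀ (l : ℕ) (H : ℝ → ℝ) (Y : E3 → ℝ) (x₀ : E3), 1 ≤ l → VirialAdmissible l H → IsSolidHarmonic l Y →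
      MemLp (sepShellL H Y x₀) 4 volume) :
    VirialWindowSilence := by
  intro l S hl hS u x₀ hcont hdiv hmild hbdd hunth Hf Yf hsep t ht ξ
  have h4' : ∀ τ ∈ S, MemLp (u τ) 4 volume := fun τ hτ => by
    obtain ⟨hH, hY, hu⟩ := hsep τ hτ
    rw [hu]
    exact h4 l _ _ _ hl hH hY
  obtain ⟨hH, hY, hu⟩ := hsep t ht
  -- the degenerate harmonic
  by_cases hYne : ∃ y : E3, Yf t y ≠ 0
  swap
  · push Not at hYne
    rw [angForm_eq_zero_of_forall_eq_zero hYne, mul_zero]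
  -- the profile is analytic: generic, or without vorticity
  have han : AnalyticOnNhd ℝ (sepShellL (Hf t) (Yf t) x₀) univ := by
    rw [← hu]; exact VirialHorn.window_analyticOnNhd_slice hS hcont hmild hbdd ht
  rcases vortAmpL_generic_or_zero (l := l) (analyticOnNhd_profile hl hY hH x₀ han hYne) with hgen | hzero
  swap
  · rw [virialMoment_eq_zero_of_vortAmpL_eq_zero hH hzero, zero_mul]
  -- generic: the pressure gauge and the open-window dictionary, as in `virialWindowSilence_of_sliceLaw`
  obtain ⟨s, T₂, hst, htT, hJS, p, hcl, hdec⟩ := exists_classical_decaying_pressure hS hcont hdiv hmild hbdd h4' ht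
  have htJ : t ∈ Ioo s T₂ := ⟨hst, htT⟩
  have hjet : ∀ x : E3, fluxJetTwo (sepShellL (Hf t) (Yf t) x₀) (p t) x₀ x = 0 := fun x => by
    rw [← hu, ← iteratedDeriv_two_threadingFlux_eq_fluxJetTwo hcl isOpen_Ioo htJ]
    exact iteratedDeriv_two_threadingFlux_eq_zero_of_unthreaded hS hunth ht x
  have hsm : ContDiff ℝ ∞ (sepShellL (Hf t) (Yf t) x₀) := by rw [← hu]; exact hcl.contDiff_velocity htJ
  have hdv : VectorCalculus.IsDivFree (sepShellL (Hf t) (Yf t) x₀) := by rw [← hu]; exact hdiv t ht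
  have hps : ContDiff ℝ ∞ (p t) := hcl.contDiff_pressure htJ
  have hcl' : Ioo s T₂ ⊆ closure (interior (Ioo s T₂)) := by
    rw [isOpen_Ioo.interior_eq]; exact subset_closure
  have hpoi : ∀ x : E3, (Δ (p t)) x =
      -VectorCalculus.divergence (convect (sepShellL (Hf t) (Yf t) x₀) (sepShellL (Hf t) (Yf t) x₀)) x := fun x => by
    rw [← hu]
    exact laplacian_pressure_eq hcl isOpen_Ioo.uniqueDiffOn hcl' htJ x
  exact hL l x₀ (Yf t) (Hf t) (p t) hl hY hH hgen hsm hdv hps hpoi hdec hjet ξ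

end Summit.NavierStokesRegularity.NavierStokesRegularity.Theorems.UnthreadedRigidity.ThreadingJets

end
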